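/-
Copyright: the b2b-balaban T⁴-continuum CRUX team, row NE7b OWNER lineage `t4-ne7b-p1` (gen 128). Project licence.
-/
import Literature.Probability.LatticeModels.LocalPerturbationClusterExpansion

/-!
# THE POLYMER GAS OF A LOCAL PERTURBATION NEEDS ONLY ACTIVITY-LEVEL SMALLNESS: polymer representation, zero-freeness, two-sided
# exclusion costs, the Kotecký–Preiss logarithm, the cluster expansion and volume-uniform extensivity `‖log Z(C)‖ ≤ #C(Δ+1)2eε` for cell
# factors that are merely INTEGRABLE, under the INTEGRATED bound `‖∫ ∏_{p∈K} g_p dμ‖ ≤ ε^{#K}` on `R`-connected `K`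
# (row NE7b, node U5c; the tree's `LocalPerturbationPolymerGas` ∕ `LocalPerturbationClusterExpansion` re-derived BY NAME with the sup bound
# `‖g_p‖ ≤ ε` replaced by the activity bound; [folklore])

Cell `pub-balaban`, sub-cell `t4`, spine estimate NE7b (`T4WeightBudget.RelWeightBound`; the cell's OWN estimate — NOT PRINTED in
[Bałaban 1983–89], NOT PROVED).  Crux-route work under `Spine/NE7b/` by the row OWNER (`t4-ne7b-p1` gen 128, file (287)) under FREEZE
(0)'s crux-prover clause, on § [NE7bP1-G127-HANDOFF] NEXT (3)(b) («DECIDE: the tree's `IsLocalPerturbation` wants SUP-bounded cell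
factors; the road's factors are bounded only on small fields»); NOTHING of Bałaban's is named as a Lean object, valued or asserted; no
`T4Continuum/Support` leaf typed; no `def`, no notation; zero `sorry`.  Imports (BY NAME): the tree's
`Literature/Probability/LatticeModels/LocalPerturbationClusterExpansion` (hence `…PolymerGas`, `PolymerGasGeometric`, `PolymerGas`,
`PolymerPushforward`, `ClusterExpansion*`): `pertZ`, `cellActivity`, `connActivity`, `rconnSubsets`, `pertLogZ`, `Touches`, `GeomInc`,
`IsRConnected`, `kpWeight`, `geomInc_dobrushin`, `sum_kpWeight_le_of_touches`, `polymerPartitionFunction_ne_zero_and_ratio_le`,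
`norm_polymerPartitionFunction_sdiff_div_le_exp`, `sum_powerset_eq_polymerPartitionFunction_of_mul`, `isKPVolume_geomInc`,
`geomInc_kp_sum_le`, `geomInc_kp_hypothesis`, `exp_polymerLogZ_of_kp`, `le_norm_polymerPartitionFunction_sdiff_div_of_kp`,
`touchSum_le_of_forall_scaleAt`, `touchSum_smul_le_of_kp`, `exists_kpTouches_singleton`; Mathlib's `IndepFun.integral_mul_eq_mul_integral`.

WHY (located; the DECISION of `g127/records/SCOPING-d2.md`).  In the tree's polymer-gas files the sup bound `‖g_p ω‖ ≤ ε` of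
`IsLocalPerturbation` enters at exactly TWO places: integrability of the products `∏_{p∈K} g_p`, and the activity bound
`‖M(K)‖ = ‖∫ ∏_{p∈K} g_p dμ‖ ≤ ε^{#K}` (`norm_cellActivity_le`); everything downstream — the factorisation over non-touching cell sets
(independence + measurability only), Dobrushin's criterion, the Kotecký–Preiss layer — is stated for abstract activities.  So the road's
cell factors `e^{−v_p(ζ)} − 1`, which are NOT sup-small (fields are unbounded) but ARE small in Gaussian mean against a quadratic regulator
(successor files (288)∕(289): `‖g_p(ζ)‖ ≤ ε·e^{½κΣ_{x∈p}ζ_x²}` and `E e^{½κΣ_{x∈Y}ζ_x²} ≤ A^{#cells}` by the tree's regulator formula), need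
neither small-field characteristic functions (option (i)) nor a new normed polymer-gas module (option (ii)): the activity-level
hypotheses below are what the regulated bound delivers, and the conclusions are VOLUME-UNIFORM.

WHAT IS PROVED ([folklore]; hypotheses always: `hle : 𝓕_p ≤ mΩ`, `hindep : ¬Touches R K₁ K₂ → Indep (⨆_{K₁}𝓕) (⨆_{K₂}𝓕) μ`,
`hmeas : Measurable[𝓕 p] (g p)`, `hint : Integrable (∏_{p∈K} g_p) μ`, `hact : IsRConnected R K → ‖cellActivity μ g K‖ ≤ ε^{#K}`, `0 ≤ ε`):
* §1 measurability ∕ integrability bookkeeping (`act_measurable_prod_iSup`, `act_measurable_prod`, `act_integrable_prod_one_add`);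
* §2 `act_pertZ_eq_sum_cellActivity` (`Z(C) = Σ_{K⊆C} M(K)`), `act_cellActivity_union` (`M(K₁ ∪ K₂) = M(K₁)M(K₂)` for non-touching
  `K₁, K₂` — NO bound needed), **`act_pertZ_eq_polymerPartitionFunction`** (`Z(C) = Ξ(𝒫(C); M)`);
* §3 `act_norm_connActivity_le` (`‖M^{conn}(X)‖ ≤ ε^{#X}` for ALL `X`), `act_connActivity_dobrushin`, **`act_pertZ_ne_zero`**,
  **`act_norm_pertZ_sdiff_div_le`** (`‖Z(C∖D)∕Z(C)‖ ≤ e^{#D(Δ+1)2eε}`), `act_norm_pertZ_sdiff_le` — under `eε(Δ+1)² ≤ 1∕2`;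
* §4 the KP layer: `act_isKPVolume_connActivity`, **`act_exp_pertLogZ`** (`exp(log Z(C)) = Z(C)`), **`act_exp_neg_le_norm_pertZ_sdiff_div`**,
  **`act_sum_norm_truncatedWeight_touching_le`** (pinned cluster sums `≤ #X(Δ+1)2eε`), THE END **`act_norm_pertLogZ_le`**
  (`‖log Z(C)‖ ≤ #C(Δ+1)2eε`, uniformly in the volume);
* §5 consistency: `hypotheses_of_isLocalPerturbation` (a sup-bounded `IsLocalPerturbation` satisfies `hint` and `hact`), so the tree's
  theorems are the special case; §6 toy.

HONEST (what this is NOT).  Abstract measure-theoretic bookkeeping on the tree's polymer-gas files; no Gaussian, no regulator, no estimate of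
the road's factors (those are (288)∕(289)∕(290)); scalar skeleton ((A3), NC-NE7b-α UNRULED); nothing of Bałaban's asserted.  BY-NAME EFFECT ON
THE WALL: NONE.  NE7b NOT PRINTED ∕ NOT PROVED; spine PROVED 0∕9; rung (B)+1 — the programme's measures remain FINITE-torus statements; NOT the
mass gap, NOT Clay.  HONEST DEPENDENCY: continuum YM on T⁴ ⇐ BetaPertH ∧ nine spine estimates (0∕9 proved); BetaPertH ⇐ (D1) ∧ (D4) ∧
CAP+tail; G-an2-4 gates asym, D1 and NE2∕3∕4.
-/

set_option autoImplicit false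

noncomputable section

namespace Summit.QuantumFields.BalabanUV.T4Continuum.NE7b.SupActivityPolymerGas

open MeasureTheory ProbabilityTheory Finset
open scoped BigOperators
open Literature.Probability.LatticeModels

variable {V : Type*} {Ω : Type*} {mΩ : MeasurableSpace Ω} {μ : Measure Ω}
  {R : V → V → Prop} {𝓕 : V → MeasurableSpace Ω} {g : V → Ω → ℂ} {ε : ℝ} {nbr : V → Finset V} {Δ : ℕ}

/-! ## §1. Measurability and integrability bookkeeping -/

/-- Products of cell factors over `K ⊆ S` are measurable for the σ-algebra generated by the cells of `S`. [folklore] -/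
theorem act_measurable_prod_iSup (hmeas : ∀ p, Measurable[𝓕 p] (g p)) {K S : Finset V} (hKS : K ⊆ S) :
    Measurable[⨆ p ∈ S, 𝓕 p] fun ω => ∏ p ∈ K, g p ω :=
  Finset.measurable_prod (m := ⨆ p ∈ S, 𝓕 p) K fun p hp =>
    (hmeas p).mono (le_iSup₂ (f := fun p (_ : p ∈ S) => 𝓕 p) p (hKS hp)) le_rfl

/-- Products of cell factors are measurable. [folklore] -/
theorem act_measurable_prod (hle : ∀ p, 𝓕 p ≤ mΩ) (hmeas : ∀ p, Measurable[𝓕 p] (g p)) (K : Finset V) :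
    Measurable fun ω => ∏ p ∈ K, g p ω :=
  (act_measurable_prod_iSup hmeas (subset_refl K)).mono (iSup₂_le fun p _ => hle p) le_rfl

/-- `∏_{p∈C}(1 + g_p) = Σ_{K⊆C} ∏_{p∈K} g_p` is integrable when the products are. [folklore] -/
theorem act_integrable_prod_one_add (hint : ∀ K : Finset V, Integrable (fun ω => ∏ p ∈ K, g p ω) μ) (C : Finset V) :
    Integrable (fun ω => ∏ p ∈ C, (1 + g p ω)) μ := by
  have h : (fun ω => ∏ p ∈ C, (1 + g p ω)) = fun ω => ∑ K ∈ C.powerset, ∏ p ∈ K, g p ω := by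
    funext ω
    rw [Finset.prod_one_add]
  rw [h]
  exact integrable_finsetSum _ fun K _ => hint K

/-! ## §2. The expansion, the factorisation and the polymer representation -/

/-- **Expanding the product**: `Z(C) = Σ_{K⊆C} M(K)` (integrable products). [folklore] -/
theorem act_pertZ_eq_sum_cellActivity (hint : ∀ K : Finset V, Integrable (fun ω => ∏ p ∈ K, g p ω) μ) (C : Finset V) :
    pertZ μ g C = ∑ K ∈ C.powerset, cellActivity μ g K := by
  unfold pertZ cellActivity
  simp_rw [Finset.prod_one_add]
  exact integral_finsetSum _ fun K _ => hint K

variable [DecidableEq V]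

/-- **Factorisation over non-touching cell sets** (finite-range dependence; NO size hypothesis on the factors):
`M(K₁ ∪ K₂) = M(K₁)M(K₂)` when `K₁, K₂` do not touch. [folklore] -/
theorem act_cellActivity_union (hle : ∀ p, 𝓕 p ≤ mΩ)
    (hindep : ∀ K₁ K₂ : Finset V, ¬ Touches R K₁ K₂ → Indep (⨆ p ∈ K₁, 𝓕 p) (⨆ p ∈ K₂, 𝓕 p) μ)
    (hmeas : ∀ p, Measurable[𝓕 p] (g p)) {K₁ K₂ : Finset V} (hK : ¬ Touches R K₁ K₂) :
    cellActivity μ g (K₁ ∪ K₂) = cellActivity μ g K₁ * cellActivity μ g K₂ := by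
  have hdisj : Disjoint K₁ K₂ := Finset.disjoint_left.2 fun p hp1 hp2 => hK ⟨p, hp1, p, hp2, Or.inl rfl⟩
  unfold cellActivity
  simp_rw [Finset.prod_union hdisj]
  have hX := act_measurable_prod_iSup hmeas (subset_refl K₁)
  have hY := act_measurable_prod_iSup hmeas (subset_refl K₂)
  have hind : IndepFun (fun ω => ∏ p ∈ K₁, g p ω) (fun ω => ∏ p ∈ K₂, g p ω) μ := by
    rw [IndepFun_iff_Indep]
    exact indep_of_indep_of_le_right (indep_of_indep_of_le_left (hindep K₁ K₂ hK) hX.comap_le) hY.comap_le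
  exact hind.integral_mul_eq_mul_integral (act_measurable_prod hle hmeas K₁).aestronglyMeasurable
    (act_measurable_prod hle hmeas K₂).aestronglyMeasurable

/-- **THE POLYMER REPRESENTATION** `Z(C) = Ξ(𝒫(C); M)`: the hard-core gas of nonempty `R`-connected subsets of `C` with the geometric
incompatibility and activity `M` — for integrable, finite-range dependent cell factors of ANY size. [folklore] -/
theorem act_pertZ_eq_polymerPartitionFunction [IsProbabilityMeasure μ] [DecidableRel R] (hR : ∀ x y, R x y → R y x)
    (hle : ∀ p, 𝓕 p ≤ mΩ) (hindep : ∀ K₁ K₂ : Finset V, ¬ Touches R K₁ K₂ → Indep (⨆ p ∈ K₁, 𝓕 p) (⨆ p ∈ K₂, 𝓕 p) μ)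
    (hmeas : ∀ p, Measurable[𝓕 p] (g p)) (hint : ∀ K : Finset V, Integrable (fun ω => ∏ p ∈ K, g p ω) μ) (C : Finset V) :
    pertZ μ g C = polymerPartitionFunction (GeomInc R) (cellActivity μ g) (rconnSubsets R C) := by
  rw [act_pertZ_eq_sum_cellActivity hint C]
  exact sum_powerset_eq_polymerPartitionFunction_of_mul hR _ (cellActivity_empty g)
    (fun K₁ K₂ hK => act_cellActivity_union hle hindep hmeas hK) C

/-! ## §3. Dobrushin's criterion from the activity bound: zero-freeness and the exclusion cost -/

variable [DecidableRel R]

omit [DecidableEq V] [DecidableRel R] in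
/-- **The truncated activities obey `‖M^{conn}(X)‖ ≤ ε^{#X}` for EVERY `X`** once the bound holds on `R`-connected sets. [folklore] -/
theorem act_norm_connActivity_le (hact : ∀ K : Finset V, IsRConnected R K → ‖cellActivity μ g K‖ ≤ ε ^ K.card) (hε : 0 ≤ ε)
    (X : Finset V) : ‖connActivity R μ g X‖ ≤ ε ^ X.card := by
  by_cases hX : IsRConnected R X
  · simpa [connActivity, hX] using hact X hX
  · simp only [connActivity, hX, if_false, norm_zero]
    exact pow_nonneg hε _

omit [DecidableEq V] [DecidableRel R] in
/-- The truncated activities vanish off `R`-connected sets. [folklore] -/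
theorem act_connActivity_eq_zero (X : Finset V) (hX : ¬ IsRConnected R X) : connActivity R μ g X = 0 := by
  simp [connActivity, hX]

/-- **Dobrushin's hypothesis** for the truncated activities under `eε(Δ+1)² ≤ 1∕2` (the tree's `geomInc_dobrushin`). [folklore] -/
theorem act_connActivity_dobrushin (hR : ∀ x y, R x y → R y x) (hΔ : ∀ x, (nbr x).card ≤ Δ) (hnbr : ∀ x y, R x y → y ∈ nbr x)
    (hact : ∀ K : Finset V, IsRConnected R K → ‖cellActivity μ g K‖ ≤ ε ^ K.card) (hε : 0 ≤ ε)
    (hsmall : Real.exp 1 * ε * ((Δ : ℝ) + 1) ^ 2 ≤ 1 / 2) (X : Finset V) (N : Finset (Finset V))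
    (hN : ∀ Y ∈ N, GeomInc R X Y) :
    ‖connActivity R μ g X‖ * ∏ Y ∈ N, (1 + kpWeight R (Real.exp 1 * ε) Y) ≤ kpWeight R (Real.exp 1 * ε) X :=
  geomInc_dobrushin hR hΔ hnbr hε hsmall _ (fun X hX => act_connActivity_eq_zero X hX)
    (fun X => act_norm_connActivity_le hact hε X) X N hN

/-- **ZERO-FREENESS**: under `eε(Δ+1)² ≤ 1∕2`, `Z(C) ≠ 0` for every finite cell set `C`. [folklore] -/
theorem act_pertZ_ne_zero [IsProbabilityMeasure μ] (hR : ∀ x y, R x y → R y x) (hΔ : ∀ x, (nbr x).card ≤ Δ)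
    (hnbr : ∀ x y, R x y → y ∈ nbr x) (hle : ∀ p, 𝓕 p ≤ mΩ)
    (hindep : ∀ K₁ K₂ : Finset V, ¬ Touches R K₁ K₂ → Indep (⨆ p ∈ K₁, 𝓕 p) (⨆ p ∈ K₂, 𝓕 p) μ)
    (hmeas : ∀ p, Measurable[𝓕 p] (g p)) (hint : ∀ K : Finset V, Integrable (fun ω => ∏ p ∈ K, g p ω) μ)
    (hact : ∀ K : Finset V, IsRConnected R K → ‖cellActivity μ g K‖ ≤ ε ^ K.card) (hε : 0 ≤ ε)
    (hsmall : Real.exp 1 * ε * ((Δ : ℝ) + 1) ^ 2 ≤ 1 / 2) (C : Finset V) : pertZ μ g C ≠ 0 := by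
  rw [act_pertZ_eq_polymerPartitionFunction hR hle hindep hmeas hint C,
    ← polymerPartitionFunction_connActivity fun X hX => (mem_rconnSubsets.1 hX).2]
  exact (polymerPartitionFunction_ne_zero_and_ratio_le (inc := GeomInc R) (geomInc_refl R)
    (fun X Y hXY => geomInc_symm R hR hXY) _ _ (kpWeight_nonneg R (mul_nonneg (Real.exp_pos 1).le hε))
    (act_connActivity_dobrushin hR hΔ hnbr hact hε hsmall) _).1

/-- **THE EXCLUSION COST IS VOLUME-UNIFORM**: under `eε(Δ+1)² ≤ 1∕2`, `‖Z(C∖D)∕Z(C)‖ ≤ exp(#D·(Δ+1)·2eε)` for all finite `C, D`.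
[folklore] -/
theorem act_norm_pertZ_sdiff_div_le [IsProbabilityMeasure μ] (hR : ∀ x y, R x y → R y x) (hΔ : ∀ x, (nbr x).card ≤ Δ)
    (hnbr : ∀ x y, R x y → y ∈ nbr x) (hle : ∀ p, 𝓕 p ≤ mΩ)
    (hindep : ∀ K₁ K₂ : Finset V, ¬ Touches R K₁ K₂ → Indep (⨆ p ∈ K₁, 𝓕 p) (⨆ p ∈ K₂, 𝓕 p) μ)
    (hmeas : ∀ p, Measurable[𝓕 p] (g p)) (hint : ∀ K : Finset V, Integrable (fun ω => ∏ p ∈ K, g p ω) μ)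
    (hact : ∀ K : Finset V, IsRConnected R K → ‖cellActivity μ g K‖ ≤ ε ^ K.card) (hε : 0 ≤ ε)
    (hsmall : Real.exp 1 * ε * ((Δ : ℝ) + 1) ^ 2 ≤ 1 / 2) (C D : Finset V) :
    ‖pertZ μ g (C \ D) / pertZ μ g C‖ ≤ Real.exp (D.card * ((Δ : ℝ) + 1) * (2 * (Real.exp 1 * ε))) := by
  set lam : ℝ := Real.exp 1 * ε with hlam_def
  have hlam : 0 ≤ lam := mul_nonneg (Real.exp_pos 1).le hε
  have hsmall' : ((Δ : ℝ) + 1) ^ 2 * lam ≤ 1 / 2 := by rw [hlam_def]; linarith [hsmall]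
  set M : Finset (Finset V) := (rconnSubsets R C).filter fun X => (X ∩ D).Nonempty with hM
  rw [act_pertZ_eq_polymerPartitionFunction hR hle hindep hmeas hint C,
    act_pertZ_eq_polymerPartitionFunction hR hle hindep hmeas hint (C \ D), rconnSubsets_sdiff C D,
    ← polymerPartitionFunction_connActivity fun X hX => (mem_rconnSubsets.1 hX).2,
    ← polymerPartitionFunction_connActivity fun X hX => (mem_rconnSubsets.1 (mem_sdiff.1 hX).1).2]
  refine (norm_polymerPartitionFunction_sdiff_div_le_exp (inc := GeomInc R) (geomInc_refl R)
    (fun X Y hXY => geomInc_symm R hR hXY) _ _ (kpWeight_nonneg R hlam)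
    (act_connActivity_dobrushin hR hΔ hnbr hact hε hsmall) (rconnSubsets R C) M).trans ?_
  refine Real.exp_le_exp.2 (sum_kpWeight_le_of_touches hR hΔ hnbr hlam hsmall' D M fun Y hY => ?_)
  obtain ⟨q, hq⟩ := (mem_filter.1 hY).2
  exact Or.inr ⟨q, (mem_inter.1 hq).2, q, (mem_inter.1 hq).1, Or.inl rfl⟩

/-- In particular `‖Z(C∖D)‖ ≤ exp(#D(Δ+1)2eε)·‖Z(C)‖`. [folklore] -/
theorem act_norm_pertZ_sdiff_le [IsProbabilityMeasure μ] (hR : ∀ x y, R x y → R y x) (hΔ : ∀ x, (nbr x).card ≤ Δ)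
    (hnbr : ∀ x y, R x y → y ∈ nbr x) (hle : ∀ p, 𝓕 p ≤ mΩ)
    (hindep : ∀ K₁ K₂ : Finset V, ¬ Touches R K₁ K₂ → Indep (⨆ p ∈ K₁, 𝓕 p) (⨆ p ∈ K₂, 𝓕 p) μ)
    (hmeas : ∀ p, Measurable[𝓕 p] (g p)) (hint : ∀ K : Finset V, Integrable (fun ω => ∏ p ∈ K, g p ω) μ)
    (hact : ∀ K : Finset V, IsRConnected R K → ‖cellActivity μ g K‖ ≤ ε ^ K.card) (hε : 0 ≤ ε)
    (hsmall : Real.exp 1 * ε * ((Δ : ℝ) + 1) ^ 2 ≤ 1 / 2) (C D : Finset V) :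
    ‖pertZ μ g (C \ D)‖ ≤ Real.exp (D.card * ((Δ : ℝ) + 1) * (2 * (Real.exp 1 * ε))) * ‖pertZ μ g C‖ := by
  have hne := act_pertZ_ne_zero hR hΔ hnbr hle hindep hmeas hint hact hε hsmall C
  have := act_norm_pertZ_sdiff_div_le hR hΔ hnbr hle hindep hmeas hint hact hε hsmall C D
  rw [norm_div, div_le_iff₀ (norm_pos_iff.2 hne)] at this
  exact this

/-! ## §4. The Kotecký–Preiss layer: `log Z`, the cluster expansion, pinned sums and extensivity -/

/-- **The truncated activities form a KP volume** on every finite family of polymers, under `eε(Δ+1)² ≤ 1∕2`. [folklore] -/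
theorem act_isKPVolume_connActivity (hR : ∀ x y, R x y → R y x) (hΔ : ∀ x, (nbr x).card ≤ Δ) (hnbr : ∀ x y, R x y → y ∈ nbr x)
    (hact : ∀ K : Finset V, IsRConnected R K → ‖cellActivity μ g K‖ ≤ ε ^ K.card) (hε : 0 ≤ ε)
    (hsmall : Real.exp 1 * ε * ((Δ : ℝ) + 1) ^ 2 ≤ 1 / 2) (𝒜 : Finset (Finset V)) :
    IsKPVolume (GeomInc R) (connActivity R μ g) (fun X => (X.card : ℝ)) 𝒜 :=
  isKPVolume_geomInc hR hΔ hnbr hε hsmall _ (fun X hX => act_connActivity_eq_zero X hX)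
    (fun X => act_norm_connActivity_le hact hε X) 𝒜

/-- **`exp(log Z(C)) = Z(C)`** (the KP branch of the logarithm of the polymer gas) under `eε(Δ+1)² ≤ 1∕2`; `R` symmetric as an instance
so that the tree's KP lemmas (for `[Std.Refl] [Std.Symm]` incompatibilities) apply to `GeomInc R`. [folklore] -/
theorem act_exp_pertLogZ [IsProbabilityMeasure μ] [Std.Symm R] (hΔ : ∀ x, (nbr x).card ≤ Δ) (hnbr : ∀ x y, R x y → y ∈ nbr x)
    (hle : ∀ p, 𝓕 p ≤ mΩ) (hindep : ∀ K₁ K₂ : Finset V, ¬ Touches R K₁ K₂ → Indep (⨆ p ∈ K₁, 𝓕 p) (⨆ p ∈ K₂, 𝓕 p) μ)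
    (hmeas : ∀ p, Measurable[𝓕 p] (g p)) (hint : ∀ K : Finset V, Integrable (fun ω => ∏ p ∈ K, g p ω) μ)
    (hact : ∀ K : Finset V, IsRConnected R K → ‖cellActivity μ g K‖ ≤ ε ^ K.card) (hε : 0 ≤ ε)
    (hsmall : Real.exp 1 * ε * ((Δ : ℝ) + 1) ^ 2 ≤ 1 / 2) (C : Finset V) :
    Complex.exp (pertLogZ μ g R C) = pertZ μ g C := by
  rw [act_pertZ_eq_polymerPartitionFunction symm_of_inst hle hindep hmeas hint C,
    ← polymerPartitionFunction_connActivity fun X hX => (mem_rconnSubsets.1 hX).2]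
  exact exp_polymerLogZ_of_kp (act_isKPVolume_connActivity symm_of_inst hΔ hnbr hact hε hsmall _) subset_rfl

/-- **Two-sided exclusion cost, lower half**: under `eε(Δ+1)² ≤ 1∕2`, `exp(−#D(Δ+1)2eε) ≤ ‖Z(C∖D)∕Z(C)‖`. [folklore] -/
theorem act_exp_neg_le_norm_pertZ_sdiff_div [IsProbabilityMeasure μ] [Std.Symm R] (hΔ : ∀ x, (nbr x).card ≤ Δ)
    (hnbr : ∀ x y, R x y → y ∈ nbr x) (hle : ∀ p, 𝓕 p ≤ mΩ)
    (hindep : ∀ K₁ K₂ : Finset V, ¬ Touches R K₁ K₂ → Indep (⨆ p ∈ K₁, 𝓕 p) (⨆ p ∈ K₂, 𝓕 p) μ)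
    (hmeas : ∀ p, Measurable[𝓕 p] (g p)) (hint : ∀ K : Finset V, Integrable (fun ω => ∏ p ∈ K, g p ω) μ)
    (hact : ∀ K : Finset V, IsRConnected R K → ‖cellActivity μ g K‖ ≤ ε ^ K.card) (hε : 0 ≤ ε)
    (hsmall : Real.exp 1 * ε * ((Δ : ℝ) + 1) ^ 2 ≤ 1 / 2) (C D : Finset V) :
    Real.exp (-(D.card * ((Δ : ℝ) + 1) * (2 * (Real.exp 1 * ε)))) ≤ ‖pertZ μ g (C \ D) / pertZ μ g C‖ := by
  have hR : ∀ x y, R x y → R y x := symm_of_inst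
  set M : Finset (Finset V) := (rconnSubsets R C).filter fun X => (X ∩ D).Nonempty with hM
  rw [act_pertZ_eq_polymerPartitionFunction hR hle hindep hmeas hint C,
    act_pertZ_eq_polymerPartitionFunction hR hle hindep hmeas hint (C \ D), rconnSubsets_sdiff C D,
    ← polymerPartitionFunction_connActivity fun X hX => (mem_rconnSubsets.1 hX).2,
    ← polymerPartitionFunction_connActivity fun X hX => (mem_rconnSubsets.1 (mem_sdiff.1 hX).1).2]
  refine le_trans (Real.exp_le_exp.2 (neg_le_neg ?_))
    (le_norm_polymerPartitionFunction_sdiff_div_of_kp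
      (act_isKPVolume_connActivity hR hΔ hnbr hact hε hsmall (rconnSubsets R C)) subset_rfl (filter_subset _ _))
  have hsum := geomInc_kp_sum_le hR hΔ hnbr hε (τ := 0) (by simpa using hsmall) (connActivity R μ g)
    (fun X hX => act_connActivity_eq_zero X hX) (fun X => act_norm_connActivity_le hact hε X) D M fun Y hY => by
      obtain ⟨q, hq⟩ := (mem_filter.1 hY).2
      exact Or.inr ⟨q, (mem_inter.1 hq).1, q, (mem_inter.1 hq).2, Or.inl rfl⟩
  simp only [zero_mul, add_zero] at hsum
  refine le_trans (sum_le_sum fun X _ => ?_) (by simpa using hsum)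
  unfold kpTerm
  rfl

/-- **PINNED CLUSTER SUMS ARE `O(ε)`**: under `eε(Δ+1)² ≤ 1∕2`, for every cell set `X`,
`Σ_{𝒞 ⊆ 𝒫(C), 𝒞 ≁ X} ‖Φ^T(𝒞)‖ ≤ #X(Δ+1)2eε` (the linear form of [KP86, (4)]). [folklore] -/
theorem act_sum_norm_truncatedWeight_touching_le (hR : ∀ x y, R x y → R y x) (hΔ : ∀ x, (nbr x).card ≤ Δ)
    (hnbr : ∀ x y, R x y → y ∈ nbr x) (hact : ∀ K : Finset V, IsRConnected R K → ‖cellActivity μ g K‖ ≤ ε ^ K.card)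
    (hε : 0 ≤ ε) (hsmall : Real.exp 1 * ε * ((Δ : ℝ) + 1) ^ 2 ≤ 1 / 2) (C X : Finset V) :
    ∑ 𝒞 ∈ (rconnSubsets R C).powerset with KPTouches (GeomInc R) 𝒞 X, ‖truncatedWeight (GeomInc R) (connActivity R μ g) 𝒞‖
      ≤ X.card * ((Δ : ℝ) + 1) * (2 * (Real.exp 1 * ε)) := by
  haveI : Std.Symm R := ⟨hR⟩
  set L := rconnSubsets R C with hL
  set w := connActivity R μ g with hw
  have hz0 : ∀ Y, ¬ IsRConnected R Y → w Y = 0 := fun Y hY => act_connActivity_eq_zero Y hY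
  have hz : ∀ Y, ‖w Y‖ ≤ ε ^ Y.card := fun Y => act_norm_connActivity_le hact hε Y
  have h1 : ∀ γ ∈ L, ∑ γ' ∈ L with GeomInc R γ' γ, ‖w γ'‖ * Real.exp ((γ'.card : ℝ) + (fun _ : Finset V => (0 : ℝ)) γ') ≤ (γ.card : ℝ) := by
    intro γ hγ
    have := geomInc_kp_hypothesis hR hΔ hnbr hε (τ := 0) (by simpa using hsmall) w hz0 hz L γ hγ
    simpa using this
  have ha : ∀ γ : Finset V, 0 ≤ (γ.card : ℝ) := fun γ => Nat.cast_nonneg _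
  have hd : ∀ γ : Finset V, 0 ≤ (fun _ : Finset V => (0 : ℝ)) γ := fun _ => le_rfl
  have hKP : IsKPVolume (GeomInc R) w (fun X => (X.card : ℝ)) L := act_isKPVolume_connActivity hR hΔ hnbr hact hε hsmall L
  have hS : ∀ t ∈ Set.Icc (0 : ℝ) 1, ∀ δ ∈ L, GeomInc R δ X →
      touchSum (GeomInc R) (scaledActivity w (scaleAt (GeomInc R) (fun _ => (1 : ℝ)) X t)) (fun _ => (0 : ℝ)) L δ ≤ (δ.card : ℝ) := by
    intro t ht δ hδ _
    have hc : scaleAt (GeomInc R) (fun _ => (1 : ℝ)) X t ∈ multCube (Finset V) 1 :=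
      mem_multCube.2 fun δ' => scaleAt_mem_Icc (fun _ => ⟨zero_le_one, le_rfl⟩) X ht δ'
    have := touchSum_smul_le_of_kp ha hd h1 1 ⟨zero_le_one, le_rfl⟩ _ hc δ hδ
    rwa [one_smul] at this
  have hmain := touchSum_le_of_forall_scaleAt (inc := GeomInc R) hd hKP (c := fun _ => (1 : ℝ)) (fun _ => ⟨zero_le_one, le_rfl⟩)
    (γ := X) hS
  rw [scaledActivity_one] at hmain
  have hlhs : touchSum (GeomInc R) w (fun _ => (0 : ℝ)) L X =
      ∑ 𝒞 ∈ L.powerset with KPTouches (GeomInc R) 𝒞 X, ‖truncatedWeight (GeomInc R) w 𝒞‖ := by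
    unfold touchSum
    refine sum_congr rfl fun 𝒞 _ => ?_
    simp
  rw [hlhs] at hmain
  refine hmain.trans ?_
  have hsum := geomInc_kp_sum_le hR hΔ hnbr hε (τ := 0) (by simpa using hsmall) w hz0 hz X (L.filter fun Y => GeomInc R Y X)
    fun Y hY => (mem_filter.1 hY).2
  simpa using hsum

/-- **THE END — EXTENSIVITY OF `log Z` WITH AN `O(ε)` DENSITY, FROM THE ACTIVITY BOUND ALONE.**  For integrable, finite-range dependent cell
factors whose activities obey `‖∫ ∏_{p∈K} g_p dμ‖ ≤ ε^{#K}` on `R`-connected `K`, under `eε(Δ+1)² ≤ 1∕2`: `‖log Z(C)‖ ≤ #C(Δ+1)2eε`,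
uniformly in the volume (every nonempty cluster touches a singleton `{p}`, `p ∈ C`; pinned clusters weigh `≤ (Δ+1)2eε`). [folklore] -/
theorem act_norm_pertLogZ_le (hR : ∀ x y, R x y → R y x) (hΔ : ∀ x, (nbr x).card ≤ Δ) (hnbr : ∀ x y, R x y → y ∈ nbr x)
    (hact : ∀ K : Finset V, IsRConnected R K → ‖cellActivity μ g K‖ ≤ ε ^ K.card) (hε : 0 ≤ ε)
    (hsmall : Real.exp 1 * ε * ((Δ : ℝ) + 1) ^ 2 ≤ 1 / 2) (C : Finset V) :
    ‖pertLogZ μ g R C‖ ≤ C.card * ((Δ : ℝ) + 1) * (2 * (Real.exp 1 * ε)) := by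
  classical
  set L := rconnSubsets R C with hL
  set Φ : Finset (Finset V) → ℂ := truncatedWeight (GeomInc R) (connActivity R μ g) with hΦ
  rw [pertLogZ_eq_sum_truncatedWeight]
  have hsplit : ∑ 𝒞 ∈ L.powerset, Φ 𝒞 = ∑ 𝒞 ∈ L.powerset with 𝒞.Nonempty, Φ 𝒞 := by
    rw [sum_filter]
    refine sum_congr rfl fun 𝒞 _ => ?_
    split_ifs with hne
    · rfl
    · rw [not_nonempty_iff_eq_empty.1 hne, hΦ, truncatedWeight_empty]
  rw [hsplit]
  refine (norm_sum_le _ _).trans ?_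
  calc ∑ 𝒞 ∈ L.powerset with 𝒞.Nonempty, ‖Φ 𝒞‖
      ≤ ∑ 𝒞 ∈ L.powerset with 𝒞.Nonempty, ∑ p ∈ C with KPTouches (GeomInc R) 𝒞 {p}, ‖Φ 𝒞‖ := by
        refine sum_le_sum fun 𝒞 h𝒞 => ?_
        obtain ⟨h𝒞L, hne⟩ := mem_filter.1 h𝒞
        obtain ⟨p, hpC, hp⟩ := exists_kpTouches_singleton (mem_powerset.1 h𝒞L) hne
        have hmem : p ∈ C.filter fun p => KPTouches (GeomInc R) 𝒞 {p} := mem_filter.2 ⟨hpC, hp⟩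
        calc ‖Φ 𝒞‖ = ∑ q ∈ ({p} : Finset V), ‖Φ 𝒞‖ := by simp
          _ ≤ _ := sum_le_sum_of_subset_of_nonneg (by simpa using hmem) fun _ _ _ => norm_nonneg _
    _ ≤ ∑ 𝒞 ∈ L.powerset, ∑ p ∈ C with KPTouches (GeomInc R) 𝒞 {p}, ‖Φ 𝒞‖ :=
        sum_le_sum_of_subset_of_nonneg (filter_subset _ _) fun _ _ _ => sum_nonneg fun _ _ => norm_nonneg _
    _ = ∑ p ∈ C, ∑ 𝒞 ∈ L.powerset with KPTouches (GeomInc R) 𝒞 {p}, ‖Φ 𝒞‖ := by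
        rw [sum_comm' (t' := C) (s' := fun p => L.powerset.filter fun 𝒞 => KPTouches (GeomInc R) 𝒞 {p})]
        intro 𝒞 p
        simp only [mem_filter]
        tauto
    _ ≤ ∑ p ∈ C, (({p} : Finset V).card : ℝ) * ((Δ : ℝ) + 1) * (2 * (Real.exp 1 * ε)) :=
        sum_le_sum fun p _ => act_sum_norm_truncatedWeight_touching_le hR hΔ hnbr hact hε hsmall C {p}
    _ = C.card * ((Δ : ℝ) + 1) * (2 * (Real.exp 1 * ε)) := by
        simp only [card_singleton, Nat.cast_one, one_mul, sum_const, nsmul_eq_mul]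
        ring

/-! ## §5. Consistency: the sup-bounded case -/

omit [DecidableEq V] [DecidableRel R] in
/-- **The tree's sup-bounded local perturbations satisfy the activity-level hypotheses**: an `IsLocalPerturbation μ R 𝓕 g ε` on a
probability space has integrable products and `‖M(K)‖ ≤ ε^{#K}` for every `K` (so §2–§4 contain the tree's theorems as the special case).
[folklore] -/
theorem hypotheses_of_isLocalPerturbation [IsProbabilityMeasure μ] (h : IsLocalPerturbation μ R 𝓕 g ε) :
    (∀ p, 𝓕 p ≤ mΩ) ∧ (∀ K₁ K₂ : Finset V, ¬ Touches R K₁ K₂ → Indep (⨆ p ∈ K₁, 𝓕 p) (⨆ p ∈ K₂, 𝓕 p) μ) ∧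
      (∀ p, Measurable[𝓕 p] (g p)) ∧ (∀ K : Finset V, Integrable (fun ω => ∏ p ∈ K, g p ω) μ) ∧
      (∀ K : Finset V, IsRConnected R K → ‖cellActivity μ g K‖ ≤ ε ^ K.card) ∧ 0 ≤ ε :=
  ⟨h.le, h.indep, h.measurable, fun K => h.integrable_prod K, fun K _ => norm_cellActivity_le h K, h.nonneg⟩

/-- The sup-bounded extensivity bound of the tree, recovered from §4. [folklore] -/
theorem norm_pertLogZ_le_of_isLocalPerturbation [IsProbabilityMeasure μ] (hR : ∀ x y, R x y → R y x)
    (hΔ : ∀ x, (nbr x).card ≤ Δ) (hnbr : ∀ x y, R x y → y ∈ nbr x) (h : IsLocalPerturbation μ R 𝓕 g ε)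
    (hsmall : Real.exp 1 * ε * ((Δ : ℝ) + 1) ^ 2 ≤ 1 / 2) (C : Finset V) :
    ‖pertLogZ μ g R C‖ ≤ C.card * ((Δ : ℝ) + 1) * (2 * (Real.exp 1 * ε)) :=
  act_norm_pertLogZ_le hR hΔ hnbr (hypotheses_of_isLocalPerturbation h).2.2.2.2.1 h.nonneg hsmall C

/-! ## §6. Toy -/

/-- Toy: with NO cells (`C = ∅`) the bound reads `‖log Z(∅)‖ ≤ 0`, for any activity data. -/
example (hR : ∀ x y, R x y → R y x) (hΔ : ∀ x, (nbr x).card ≤ Δ) (hnbr : ∀ x y, R x y → y ∈ nbr x)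
    (hact : ∀ K : Finset V, IsRConnected R K → ‖cellActivity μ g K‖ ≤ ε ^ K.card) (hε : 0 ≤ ε)
    (hsmall : Real.exp 1 * ε * ((Δ : ℝ) + 1) ^ 2 ≤ 1 / 2) : ‖pertLogZ μ g R ∅‖ ≤ 0 := by
  have h := act_norm_pertLogZ_le hR hΔ hnbr hact hε hsmall ∅
  simpa using h

end Summit.QuantumFields.BalabanUV.T4Continuum.NE7b.SupActivityPolymerGas
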